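import Summits.PneNP.PneNP.Theorems.SmallBlockRothvossBallGridCore
import HarnessLib

/-!
# Block psd factorizations from SUPPORT-rectangle bounds: cells and net (cell pnp-psdrank, eng g5)

File 1 of the support-rectangle block chain (`SupportRectangleBlockLift*`). The cube-grid net behind the
cell's block bound for the perfect matching polytope (`SmallBlockRothvossBallGrid.netBall_dominated` /
`core_at`: every `(S^b_+)^m` psd lift of `P_PM(n)` has `2^{c n/(b+1)} ≤ m · n⁹`) is fed there by Rothvoß's
ALL-rectangle hyperplane datum. The same argument only ever uses the rectangle bound on rectangles on which
the pairing `⟪a_x, c_y⟫` vanishes nowhere: on a GOOD cell pair `|⟪a,c⟫| ≥ κ − e > 0` (or `κ = e = 0` and the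
pairing vanishes identically). This file proves the support forms

* `rect_bound_supp`, `cells_bound_supp` — cell-pair accounting with the rectangle bound `Σ_{X×Y} W ≤ θ₀`
  assumed only for rectangles on which the pairing `d` is nowhere zero;
* `netBall_supp` — the cube-grid net in the same form: `Σ W⟪a,c⟫² ≤ (2L+1)^{2b} θ₀ + η Σ K⟪a,c⟫² + τ ΣK`.

Consumer: `SupportRectangleBlockLift` (abstract core: a rectangle bound INSIDE THE SUPPORT of the
factorized matrix suffices, since every square-root piece vanishes wherever the matrix does) and
`SupportRectangleBlockLiftUDISJ` (Kaibel–Weltge ⇒ `(3/2)^{n/(b+1)} ≤ m · 14400 b⁵ n⁶` for `(S^b_+)^m`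
factorizations of the unique-disjointness matrix / block-diagonal SDP lifts of the correlation polytope,
cf. [cite: FawziParrilo2013, Thm. 1]). [cite: Rothvoss2017, Lemma 5 (support-form hyperplane bound)]
WHAT THIS IS NOT: nothing here bounds general psd rank; nothing is P ≠ NP-relevant.
-/

set_option linter.dupNamespace false -- `Summit.PneNP.PneNP.…`: summit = sub-problem (D-0017)

noncomputable section

open scoped Classical

open Finset Real Summit.PneNP.PneNP.Theorems.SmallBlockRothvossBallGrid

namespace Summit.PneNP.PneNP.Theorems.SupportRectangleBlockLift

section Cells

variable {α β γ γ' : Type*} [Fintype α] [Fintype β] [DecidableEq γ] [DecidableEq γ']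

omit [Fintype α] [Fintype β] in
/-- **One cell pair, support form.** As `SmallBlockRothvossBallGrid.rect_bound`, but the rectangle bound
`Σ_{X×Y} W ≤ θ₀` is only required when the pairing `d` vanishes nowhere on `X × Y`: on a good cell pair
either `|d| ≥ κ − e > 0` throughout, or `κ = e = 0` and `d ≡ 0` there. -/
theorem rect_bound_supp (W K d : α → β → ℝ) (X : Finset α) (Y : Finset β) (κ e η τ θ₀ : ℝ)
    (hWK : ∀ x y, W x y ≤ K x y) (hK : ∀ x y, 0 ≤ K x y) (hη : 0 < η) (hη1 : η ≤ 1)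
    (he : 0 ≤ e) (hθ : 0 ≤ θ₀)
    (hrect : (∀ x ∈ X, ∀ y ∈ Y, d x y ≠ 0) → ∑ x ∈ X, ∑ y ∈ Y, W x y ≤ θ₀) (hκ : 0 ≤ κ)
    (hlo : ∀ x ∈ X, ∀ y ∈ Y, κ - e ≤ |d x y|) (hhi : ∀ x ∈ X, ∀ y ∈ Y, |d x y| ≤ κ + e)
    (hd1 : ∀ x y, d x y ^ 2 ≤ 1) (hτ : ((6 / η + 2) * e) ^ 2 ≤ τ) :
    ∑ x ∈ X, ∑ y ∈ Y, W x y * d x y ^ 2 ≤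
      θ₀ + η * ∑ x ∈ X, ∑ y ∈ Y, K x y * d x y ^ 2 + τ * ∑ x ∈ X, ∑ y ∈ Y, K x y := by
  have hKd : 0 ≤ ∑ x ∈ X, ∑ y ∈ Y, K x y * d x y ^ 2 :=
    sum_nonneg fun x _ => sum_nonneg fun y _ => mul_nonneg (hK x y) (sq_nonneg _)
  have hKs : 0 ≤ ∑ x ∈ X, ∑ y ∈ Y, K x y := sum_nonneg fun x _ => sum_nonneg fun y _ => hK x y
  have hτ0 : 0 ≤ τ := le_trans (sq_nonneg _) hτ
  -- `d² ≤ (κ + e)²` everywhere on the rectangle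
  have hhi2 : ∀ x ∈ X, ∀ y ∈ Y, d x y ^ 2 ≤ (κ + e) ^ 2 := by
    intro x hx y hy
    have h1 := hhi x hx y hy
    have h0 : 0 ≤ |d x y| := abs_nonneg _
    rw [← sq_abs (d x y)]
    exact pow_le_pow_left₀ h0 h1 2
  by_cases hgood : (6 / η + 1) * e ≤ κ
  · -- GOOD cell pair: multiplicative sandwich
    obtain ⟨hκe, hratio⟩ := good_cell hη hη1 he hgood
    have hlo2 : ∀ x ∈ X, ∀ y ∈ Y, (κ - e) ^ 2 ≤ d x y ^ 2 := by
      intro x hx y hy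
      rw [← sq_abs (d x y)]
      exact pow_le_pow_left₀ hκe (hlo x hx y hy) 2
    have hpt : ∀ x ∈ X, ∀ y ∈ Y,
        W x y * d x y ^ 2 ≤ (κ - e) ^ 2 * W x y + η * (K x y * d x y ^ 2) :=
      fun x hx y hy => pointwise_good (hWK x y) (hK x y) hη.le (hlo2 x hx y hy) (hhi2 x hx y hy) hratio
    have hsum : ∑ x ∈ X, ∑ y ∈ Y, W x y * d x y ^ 2 ≤
        (κ - e) ^ 2 * ∑ x ∈ X, ∑ y ∈ Y, W x y + η * ∑ x ∈ X, ∑ y ∈ Y, K x y * d x y ^ 2 := by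
      calc ∑ x ∈ X, ∑ y ∈ Y, W x y * d x y ^ 2
          ≤ ∑ x ∈ X, ∑ y ∈ Y, ((κ - e) ^ 2 * W x y + η * (K x y * d x y ^ 2)) :=
            sum_le_sum fun x hx => sum_le_sum fun y hy => hpt x hx y hy
        _ = (κ - e) ^ 2 * ∑ x ∈ X, ∑ y ∈ Y, W x y + η * ∑ x ∈ X, ∑ y ∈ Y, K x y * d x y ^ 2 := by
            simp only [sum_add_distrib, mul_sum]
    by_cases hnz : ∀ x ∈ X, ∀ y ∈ Y, d x y ≠ 0
    · -- the pairing vanishes nowhere: the rectangle lies in the support, `hrect` applies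
      have hrect' := hrect hnz
      rcases (X ×ˢ Y).eq_empty_or_nonempty with hempty | hne
      · have hXY : ∀ (F : α → β → ℝ), ∑ x ∈ X, ∑ y ∈ Y, F x y = 0 := by
          intro F
          rw [← sum_product' (f := fun x y => F x y), hempty, sum_empty]
        rw [hXY, hXY, hXY]
        linarith
      · obtain ⟨p, hp⟩ := hne
        rw [mem_product] at hp
        have h1 : (κ - e) ^ 2 ≤ 1 := (hlo2 p.1 hp.1 p.2 hp.2).trans (hd1 p.1 p.2)
        have h2 : (κ - e) ^ 2 * ∑ x ∈ X, ∑ y ∈ Y, W x y ≤ θ₀ := by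
          calc (κ - e) ^ 2 * ∑ x ∈ X, ∑ y ∈ Y, W x y ≤ (κ - e) ^ 2 * θ₀ :=
                mul_le_mul_of_nonneg_left hrect' (sq_nonneg _)
            _ ≤ 1 * θ₀ := mul_le_mul_of_nonneg_right h1 hθ
            _ = θ₀ := one_mul θ₀
        nlinarith [mul_nonneg hτ0 hKs]
    · -- some pairing vanishes on the rectangle: then `κ = e = 0` and `d ≡ 0` there
      push Not at hnz
      obtain ⟨x, hx, y, hy, hd0⟩ := hnz
      have h1 : (κ - e) ^ 2 ≤ 0 := by
        have := hlo2 x hx y hy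
        rw [hd0] at this
        simpa using this
      have hκe0 : κ - e = 0 := by nlinarith [sq_nonneg (κ - e)]
      have hke : (κ + e) ^ 2 ≤ 0 := by
        have : (1 + η) * (κ - e) ^ 2 = 0 := by rw [hκe0]; ring
        linarith [hratio]
      have hd0' : ∀ x ∈ X, ∀ y ∈ Y, d x y ^ 2 = 0 :=
        fun x hx y hy => le_antisymm ((hhi2 x hx y hy).trans hke) (sq_nonneg _)
      have hL0 : ∑ x ∈ X, ∑ y ∈ Y, W x y * d x y ^ 2 = 0 :=
        sum_eq_zero fun x hx => sum_eq_zero fun y hy => by rw [hd0' x hx y hy, mul_zero]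
      rw [hL0]
      nlinarith [mul_nonneg hη.le hKd, mul_nonneg hτ0 hKs]
  · -- GARBAGE cell pair: uniformly small entries
    push Not at hgood
    have hτ' : (κ + e) ^ 2 ≤ τ := by
      refine le_trans ?_ hτ
      have h1 : κ + e ≤ (6 / η + 2) * e := by nlinarith
      have h0 : 0 ≤ κ + e := by linarith
      exact pow_le_pow_left₀ h0 h1 2
    have hpt : ∀ x ∈ X, ∀ y ∈ Y, W x y * d x y ^ 2 ≤ τ * K x y :=
      fun x hx y hy => pointwise_garbage (hWK x y) (hK x y) (hhi2 x hx y hy) hτ'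
    have hsum : ∑ x ∈ X, ∑ y ∈ Y, W x y * d x y ^ 2 ≤ τ * ∑ x ∈ X, ∑ y ∈ Y, K x y := by
      calc ∑ x ∈ X, ∑ y ∈ Y, W x y * d x y ^ 2 ≤ ∑ x ∈ X, ∑ y ∈ Y, τ * K x y :=
            sum_le_sum fun x hx => sum_le_sum fun y hy => hpt x hx y hy
        _ = τ * ∑ x ∈ X, ∑ y ∈ Y, K x y := by simp only [mul_sum]
    nlinarith [mul_nonneg hη.le hKd]

/-- **All cell pairs, support form.** As `SmallBlockRothvossBallGrid.cells_bound`, with the rectangle bound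
required only on rectangles on which the pairing `d` vanishes nowhere. -/
theorem cells_bound_supp (W K d : α → β → ℝ) (cA : α → γ) (cB : β → γ') (BoxA : Finset γ)
    (BoxB : Finset γ') (κ : γ → γ' → ℝ) (e η τ θ₀ : ℝ)
    (hA : ∀ x, cA x ∈ BoxA) (hB : ∀ y, cB y ∈ BoxB)
    (hWK : ∀ x y, W x y ≤ K x y) (hK : ∀ x y, 0 ≤ K x y) (hη : 0 < η) (hη1 : η ≤ 1)
    (he : 0 ≤ e) (hθ : 0 ≤ θ₀)
    (hrect : ∀ (X : Finset α) (Y : Finset β), (∀ x ∈ X, ∀ y ∈ Y, d x y ≠ 0) →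
      ∑ x ∈ X, ∑ y ∈ Y, W x y ≤ θ₀)
    (hκ : ∀ i j, 0 ≤ κ i j)
    (hlo : ∀ x y, κ (cA x) (cB y) - e ≤ |d x y|) (hhi : ∀ x y, |d x y| ≤ κ (cA x) (cB y) + e)
    (hd1 : ∀ x y, d x y ^ 2 ≤ 1) (hτ : ((6 / η + 2) * e) ^ 2 ≤ τ) :
    ∑ x, ∑ y, W x y * d x y ^ 2 ≤
      (BoxA.card * BoxB.card) * θ₀ + η * ∑ x, ∑ y, K x y * d x y ^ 2 + τ * ∑ x, ∑ y, K x y := by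
  rw [sum_sum_cells (fun x y => W x y * d x y ^ 2) cA cB BoxA BoxB hA hB,
    sum_sum_cells (fun x y => K x y * d x y ^ 2) cA cB BoxA BoxB hA hB,
    sum_sum_cells K cA cB BoxA BoxB hA hB]
  have hcell : ∀ i ∈ BoxA, ∀ j ∈ BoxB,
      ∑ x ∈ univ.filter (fun x => cA x = i), ∑ y ∈ univ.filter (fun y => cB y = j),
          W x y * d x y ^ 2 ≤
        θ₀ + η * ∑ x ∈ univ.filter (fun x => cA x = i), ∑ y ∈ univ.filter (fun y => cB y = j),
            K x y * d x y ^ 2 +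
          τ * ∑ x ∈ univ.filter (fun x => cA x = i), ∑ y ∈ univ.filter (fun y => cB y = j),
            K x y := by
    intro i _ j _
    refine rect_bound_supp W K d _ _ (κ i j) e η τ θ₀ hWK hK hη hη1 he hθ (fun hnz => hrect _ _ hnz)
      (hκ i j) ?_ ?_ hd1 hτ
    · intro x hx y hy
      rw [mem_filter] at hx hy
      rw [← hx.2, ← hy.2]
      exact hlo x y
    · intro x hx y hy
      rw [mem_filter] at hx hy
      rw [← hx.2, ← hy.2]
      exact hhi x y
  calc _ ≤ ∑ i ∈ BoxA, ∑ j ∈ BoxB,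
        (θ₀ + η * ∑ x ∈ univ.filter (fun x => cA x = i), ∑ y ∈ univ.filter (fun y => cB y = j),
            K x y * d x y ^ 2 +
          τ * ∑ x ∈ univ.filter (fun x => cA x = i), ∑ y ∈ univ.filter (fun y => cB y = j),
            K x y) := sum_le_sum fun i hi => sum_le_sum fun j hj => hcell i hi j hj
    _ = _ := by
        simp only [sum_add_distrib, sum_const, ← mul_sum]
        ring

end Cells

section Net

variable {b : ℕ}

/-- **The cube-grid net, support form.** As `SmallBlockRothvossBallGrid.netBall_dominated` — weights
`W ≤ K`, `K ≥ 0`, vectors `a_x, c_y ∈ ℝ^b` of norm `≤ 1`, grid resolution `L` with `b ≤ L²`: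
`Σ W⟪a,c⟫² ≤ (2L+1)^{2b} θ₀ + η Σ K⟪a,c⟫² + τ ΣK` for `τ ≥ 112 b/(η²L²)` — but the rectangle bound
`Σ_{X×Y} W ≤ θ₀` is only assumed for rectangles on which `⟪a_x, c_y⟫ ≠ 0`. -/
theorem netBall_supp {α β : Type*} [Fintype α] [Fintype β] (W K : α → β → ℝ) (θ₀ η τ : ℝ)
    (L : ℕ) (a : α → Fin b → ℝ) (c : β → Fin b → ℝ) (hK0 : ∀ x y, 0 ≤ K x y)
    (hWK : ∀ x y, W x y ≤ K x y) (hθ : 0 ≤ θ₀) (hη : 0 < η) (hη1 : η ≤ 1) (hL : 0 < L)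
    (hbL : b ≤ L ^ 2) (ha : ∀ x, a x ⬝ᵥ a x ≤ 1) (hc : ∀ y, c y ⬝ᵥ c y ≤ 1)
    (hrect : ∀ (X : Finset α) (Y : Finset β), (∀ x ∈ X, ∀ y ∈ Y, a x ⬝ᵥ c y ≠ 0) →
      ∑ x ∈ X, ∑ y ∈ Y, W x y ≤ θ₀)
    (hτ : 112 * b / (η ^ 2 * (L : ℝ) ^ 2) ≤ τ) :
    ∑ x, ∑ y, W x y * (a x ⬝ᵥ c y) ^ 2 ≤
      ((2 * L + 1 : ℝ) ^ b) ^ 2 * θ₀ + η * ∑ x, ∑ y, K x y * (a x ⬝ᵥ c y) ^ 2 +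
        τ * ∑ x, ∑ y, K x y := by
  classical
  have hL' : (0 : ℝ) < L := by exact_mod_cast hL
  set esq : ℝ := 7 * b / (4 * (L : ℝ) ^ 2) with hesq
  have hesq0 : 0 ≤ esq := by positivity
  set e : ℝ := Real.sqrt esq with he
  have he0 : 0 ≤ e := Real.sqrt_nonneg _
  have hee : e ^ 2 = esq := Real.sq_sqrt hesq0
  -- the cell data
  set κ : (Fin b → ℤ) → (Fin b → ℤ) → ℝ := fun i j => |ctr L i ⬝ᵥ ctr L j| with hκ
  have hdist : ∀ x y, |a x ⬝ᵥ c y - ctr L (cell L (a x)) ⬝ᵥ ctr L (cell L (c y))| ≤ e := by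
    intro x y
    rw [← Real.sqrt_sq_eq_abs, he]
    exact Real.sqrt_le_sqrt (distortion_sq_le hL hbL (ha x) (hc y))
  have hlo : ∀ x y, κ (cell L (a x)) (cell L (c y)) - e ≤ |a x ⬝ᵥ c y| := by
    intro x y
    have h1 := hdist x y
    have h2 := abs_sub_abs_le_abs_sub (ctr L (cell L (a x)) ⬝ᵥ ctr L (cell L (c y))) (a x ⬝ᵥ c y)
    rw [abs_sub_comm] at h2
    simp only [hκ]
    linarith
  have hhi : ∀ x y, |a x ⬝ᵥ c y| ≤ κ (cell L (a x)) (cell L (c y)) + e := by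
    intro x y
    have h1 := hdist x y
    have h2 := abs_add_le (ctr L (cell L (a x)) ⬝ᵥ ctr L (cell L (c y)))
      (a x ⬝ᵥ c y - ctr L (cell L (a x)) ⬝ᵥ ctr L (cell L (c y)))
    rw [add_sub_cancel] at h2
    simp only [hκ]
    linarith
  have hd1 : ∀ x y, (a x ⬝ᵥ c y) ^ 2 ≤ 1 := by
    intro x y
    have h1 := dotProduct_sq_le_mul (ha x) (hc y)
    linarith
  have hτ' : ((6 / η + 2) * e) ^ 2 ≤ τ := by
    refine le_trans ?_ hτ
    have h1 : ((6 / η + 2) * e) ^ 2 = (6 / η + 2) ^ 2 * esq := by rw [mul_pow, hee]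
    rw [h1]
    have h2 : (6 / η + 2) ^ 2 ≤ (8 / η) ^ 2 := by
      have h3 : 6 / η + 2 ≤ 8 / η := by
        rw [div_add' _ _ _ hη.ne', div_le_div_iff_of_pos_right hη]; linarith
      exact pow_le_pow_left₀ (by positivity) h3 2
    calc (6 / η + 2) ^ 2 * esq ≤ (8 / η) ^ 2 * esq := mul_le_mul_of_nonneg_right h2 hesq0
      _ = 112 * b / (η ^ 2 * (L : ℝ) ^ 2) := by rw [hesq]; field_simp; ring
  have key := cells_bound_supp W K (fun x y => a x ⬝ᵥ c y) (fun x => cell L (a x))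
    (fun y => cell L (c y)) (box b L) (box b L) κ e η τ θ₀ (fun x => cell_mem_box (ha x))
    (fun y => cell_mem_box (hc y)) hWK hK0 hη hη1 he0 hθ hrect (fun i j => abs_nonneg _) hlo hhi hd1 hτ'
  rw [card_box] at key
  simpa only [sq] using key

end Net

end Summit.PneNP.PneNP.Theorems.SupportRectangleBlockLift

end
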